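import Mathlib
import HarnessLib
import Literature.Dynamics.Hamiltonian.KaloshinZhang2020.SlowSystemShapes

/-!
# Kaloshin–Zhang 2018 (Bull. SMF 146): dominant Hamiltonians at a multiple resonance — the DEFINITIONS of §§1–2 typed exactly for every `n`, `d = m + w`, and the linear algebra behind them kernel-checked

CITATION HEADER (lean-in-tree rule 2026-08-18). Source: V. Kaloshin, K. Zhang, *Dynamics of the dominant
Hamiltonian*, Bull. Soc. Math. France **146** (2018) no. 3, 517–574, doi:10.24033/bsmf.2765 = bib key
`KaloshinZhang2018` — REFEREED, PUBLISHED. READ IN: arXiv:1410.1844v2 (2015, 84 pp., subtitle "with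
applications to Arnold diffusion"), TeX source `dominant-arxiv-v2.tex`; every locator `l.NNN` below is a line of
that file and "Theorem 2.k" is the arXiv v2 numbering (the journal pagination is not available to the cell that
wrote this file, run/shared/lean/pub/pub-arnold; its abstract on the SMF page describes exactly the content of
§§1–2 typed here). The arXiv Appendix A ("diffusion path with dominant structure", outline proofs by the authors'
own statement l.2725) is NOT reproduced and nothing here depends on it.

WHY THIS FILE EXISTS. For `n = 2` the slow system at a double resonance is a 2-degree-of-freedom mechanical
system and "the structure of its (minimal) orbits is well understood … This is no longer the case when n > 2,
which is a serious obstacle to proving Arnold diffusion in higher degrees of freedom" (l.352–357). The paper's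
way around it — restrict to resonances with a DOMINANT STRUCTURE and compare the slow system with the STRONG
system — is, with KZ20 Ch. 14 (`KaloshinZhang2020.SlowSystemShapes`), one of the few refereed texts on the
slow dynamics at multiple resonances in `n ≥ 3` degrees of freedom, and the one the `n ≥ 3` a-priori-stable
programme cites for this step. This module types its vocabulary so that the open statements of that programme
can be written over real definitions.

WHAT IS REPRODUCED EXACTLY (definitions; l. = arXiv v2 line):
* resonance lattices `Λ ⊂ ℤⁿ⁺¹` ("a subgroup … which does not contain vectors of the type (0, ⋯, 0, k⁰)",
  l.316), irreducibility ("Span_ℝ Λ ∩ ℤⁿ⁺¹ = Λ", l.320, in the equivalent saturation form), the sup-norm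
  `|k| = sup_i |k_i|` and the relative norm `M(Λ|Λˢᵗ) = min_{k ∈ Λ ∖ Λˢᵗ} |k|` (l.385–391), ordered and ADAPTED
  bases `𝓑 = [𝓑ˢᵗ, 𝓑ʷᵏ]` (l.343, l.391–393, l.538–541), resonance manifolds `Γ_k`, `Γ_Λ` (l.315–320);
* the slow system's kinetic energy (eq. (Kn) l.374–377 = eq. (Kd) l.521–524) `K_{p₀,𝓑}(I) = ½ Q(p₀)(I₁k₁ + ⋯ + I_dk_d) ·
  (I₁k₁ + ⋯ + I_dk_d)` with the PADDED Hessian `Q(p) = [[Q₀(p), 0], [0, 0]]`, `Q₀ = ∂²ₚₚH₀` (l.517–520, l.630), and its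
  Hessian blocks (eq. (ABC), l.708–711) `A_{ij} = (kᵢˢᵗ)ᵀ Q kⱼˢᵗ`, `B_{ij} = (kᵢˢᵗ)ᵀ Q kⱼʷᵏ`, `C_{ij} = (kᵢʷᵏ)ᵀ Q kⱼʷᵏ`;
* the Fourier restriction `Z_𝓑` at coefficient level (eq. (ZB), l.525–533) and the strong/weak splitting of the
  potential (l.549–557);
* the abstract space `Ω^{m,d}_{κ,q}(𝓑ˢᵗ)` of `(m,d)`-dominant Hamiltonians (§2.2, l.636–667) with
  `𝔐(𝓑ʷᵏ) = min_j |kⱼʷᵏ|`, and the quantifier SHAPE of Theorem 2.1 (l.600–614);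
* the half-Lagrangian coordinates, `C̃ = C − BᵀA⁻¹B`, `c̄ = cˢᵗ + A⁻¹Bcʷᵏ` (l.733–746, l.1466–1473), the vector
  fields (Hs-Lag)/(Xst)/(Xs)/(XstL) (l.712–731, l.747–770) and the rescaling `Φ_Σ` (l.771–782).

WHAT IS PROVED (kernel-checked linear algebra; every `n`, `m`, `w`):
* (Kn) = (Kd): the padded `Q` sees only the space components (`dotProduct_padQ_mulVec`, `kinetic_eq_padded`);
* for vectors of a resonance lattice, ℤ-linear independence forces ℝ-linear independence of the SPACE components
  (`ResonanceLattice.linearIndependent_spaceRows` — the lattice axiom "no (0, …, 0, k⁰)" is exactly what is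
  used; `Γ_Λ = ⋂ᵢ Γ_{kᵢ}` for a spanning family is `resonanceManifold_eq_iInter_of_span`), hence `K_{p₀,𝓑}` is
  positive definite whenever `Q₀ = ∂²ₚₚH₀(p₀)` is (`hessK_posDef`): the slow system
  at ANY `d`-resonance is a genuine mechanical system;
* `Kˢᵗ(Iˢᵗ) = Kˢ(Iˢᵗ, 0)` (l.402–405, l.561–564; `kinetic_append_zero`), `Z_{[𝓑ˢᵗ,𝓑ʷᵏ]}|_{lʷᵏ = 0} = Z_{𝓑ˢᵗ}`
  (`ZBcoeff_append_zero`) and the block form of `∂²K`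
  (`hessK_append_*`);
* in `Ω_{κ,q}`: `‖Uⱼʷᵏ‖ ≤ κ 𝔐(𝓑ʷᵏ)^{−q}` (l.665–667; `OmegaPoint.InOmega.norm_le_of_minWeak`), and Theorem 2.1's
  conclusion is membership in `Ω_{κ, r−n−2(d−m)−4}` (l.669–675; `Theorem21Shape.inOmega`);
* the half-Lagrangian identity `vʷᵏ = BᵀA⁻¹vˢᵗ + C̃ Iʷᵏ` (`BlockForm.vWk_eq_halfLagrangian`) — the arXiv text l.744
  prints "− C̃ Iʷᵏ" (and l.740 "vʷᵏ = BᵀIʷᵏ + CIʷᵏ" for "BᵀIˢᵗ + CIʷᵏ"); the kernel decides the sign;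
* `A c̄ = (∂²K c)ˢᵗ` (`BlockForm.mulVec_cbar`): `c̄` is the strong momentum with the same strong velocity;
* the ENERGY form of Lemma 5.1 / Proposition 5.3 at `U ≡ 0`: `K(c) = Kˢᵗ(c̄) + ½ cʷᵏ · C̃ cʷᵏ`
  (`BlockForm.Kblock_eq_strong_add_schur`, transported to the slow system by `kinetic_append_eq_Kblock`) — so
  `α_{Hˢ}(c) = α_{Hˢᵗ}(c̄) + ½ cʷᵏ · C̃cʷᵏ` for the integrable system,
  which fixes the sign in the two displays that disagree inside arXiv v2 (l.961 "+ ½ cʷᵏ·C̃cʷᵏ" in §2.4 versus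
  Lemma 5.1 l.1478 "− ½ cʷᵏ·C̃cʷᵏ"; Proposition 5.3 l.1885 versus its proof l.1893–1896): Lemma 5.1's sign is
  the consistent one;
* Lemma 5.1 (1)–(2) themselves in the momentum parametrisation `v = ∂K(I)` (`BlockForm.lemma51_energy`,
  `lemma51_pairing`, `lemma51_square`); `C̃` is positive definite whenever `∂²K` is (`BlockForm.schurC_posDef`,
  `schurC_posDef_of_mem` — the "invertible symmetric matrix" of l.746);
* `X^{st}_L` is invariant under the rescaling `Φ_Σ` (l.782; `HalfLag.rescaledField_XstL`), and the strong
  projection of `Xˢ − Xˢᵗ_L` is `(0, A∂_{φˢᵗ}Uʷᵏ + B∂_{φʷᵏ}Uʷᵏ)` (`FieldData.strongProjection_sub`; l.731 names only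
  the `B`-term).

WHAT IS NOT REPRODUCED (analysis; cited only, never used as hypotheses here): the basis-selection Theorem 2.1
itself (number theory of the adapted basis + `Cʳ` Fourier decay, §3), the rescaling estimates Theorem 2.2, NHWICs
and their persistence Theorem 2.3 (App. C), weak KAM solutions and Theorem 2.4 (§§5–7). No closed "∀ H, …"
proposition is stated; `Theorem21Shape` is a predicate recording the quantifier shape only. The cell's
DIVERGENCE.md rows D9 (missing "𝔐(𝓑ʷᵏ) ≥ M" in Theorem 2.3 as printed) and D28 (the sign/typo items above,
all arXiv-v2 readings; whether the journal text repairs them is not known to us) record the wording issues.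

Companion files: `KaloshinZhang2020.SlowSystemShapes` (the `d = n` frame `B ∈ SL(n+1, ℤ)` and the energy
reduction), `KaloshinZhang2020.TheoremShapes`.
-/

noncomputable section

open Matrix Finset

namespace Literature.Dynamics.Hamiltonian.KaloshinZhang2018

open Literature.Dynamics.Hamiltonian.KaloshinZhang2020 (freqExt)

variable {n : ℕ}

/-! ### Integer vectors `k = (k̄, k⁰) ∈ ℤⁿ × ℤ`, resonance lattices, norms -/

/-- Integer frequency vectors `k = (k̄, k⁰) ∈ ℤⁿ × ℤ = ℤⁿ⁺¹`, time component LAST (the convention of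
`KaloshinZhang2020.SlowSystemShapes`, rows of the frame `B`). [cite: KaloshinZhang2018, §1 l.315–316] -/
abbrev IntVec (n : ℕ) := Fin (n + 1) → ℤ

/-- Space part `k̄ ∈ Rⁿ` of `k = (k̄, k⁰)`. [cite: KaloshinZhang2018, §1 l.315] -/
def spacePart {R : Type*} (k : Fin (n + 1) → R) : Fin n → R := fun i => k i.castSucc

/-- Time part `k⁰` of `k = (k̄, k⁰)`. [cite: KaloshinZhang2018, §1 l.315] -/
def timePart {R : Type*} (k : Fin (n + 1) → R) : R := k (Fin.last n)

/-- Unfolding of `spacePart`. [folklore] -/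
@[simp] theorem spacePart_apply {R : Type*} (k : Fin (n + 1) → R) (i : Fin n) :
    spacePart k i = k i.castSucc := rfl

/-- `spacePart` is additive. [folklore] -/
@[simp] theorem spacePart_add {R : Type*} [Add R] (k k' : Fin (n + 1) → R) :
    spacePart (k + k') = spacePart k + spacePart k' := rfl

/-- `spacePart` commutes with scalars. [folklore] -/
@[simp] theorem spacePart_smul {R S : Type*} [SMul S R] (c : S) (k : Fin (n + 1) → R) :
    spacePart (c • k) = c • spacePart k := rfl

/-- `spacePart 0 = 0`. [folklore] -/
@[simp] theorem spacePart_zero {R : Type*} [Zero R] : spacePart (0 : Fin (n + 1) → R) = 0 := rfl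

/-- The sup-norm `|k| = sup_i |k_i|` of an integer vector (l.391: "where |k| = sup_i |k_i| is the sup-norm"),
as a natural number. [cite: KaloshinZhang2018, §1 l.391] -/
def supNorm (k : IntVec n) : ℕ := Finset.univ.sup fun i => (k i).natAbs

/-- Each coordinate is bounded by the sup-norm. [folklore] -/
theorem natAbs_le_supNorm (k : IntVec n) (i : Fin (n + 1)) : (k i).natAbs ≤ supNorm k :=
  Finset.le_sup (f := fun i => (k i).natAbs) (Finset.mem_univ i)

/-- The real vector underlying an integer vector. [folklore] -/
def realVec (k : IntVec n) : Fin (n + 1) → ℝ := fun j => (k j : ℝ)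

/-- Unfolding of `realVec`. [folklore] -/
@[simp] theorem realVec_apply (k : IntVec n) (j : Fin (n + 1)) : realVec k j = (k j : ℝ) := rfl

/-- **Resonance lattice** (l.316, verbatim): "we consider a subgroup Λ of ℤⁿ⁺¹ which does not contain vectors
of the type (0, ⋯, 0, k⁰), called a *resonance lattice*." Typed as a `ℤ`-submodule of `ℤⁿ⁺¹` (= subgroup) in
which a vector with zero SPACE part is zero. [cite: KaloshinZhang2018, §1 l.316] -/
structure ResonanceLattice (n : ℕ) where
  /-- the subgroup `Λ ≤ ℤⁿ⁺¹` -/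
  carrier : Submodule ℤ (IntVec n)
  /-- no vectors `(0, …, 0, k⁰)` with `k⁰ ≠ 0` -/
  no_temporal : ∀ k ∈ carrier, spacePart k = 0 → k = 0

namespace ResonanceLattice

/-- The **rank** of `Λ` (l.316: "the dimension of the real subspace containing it"); for a subgroup of `ℤⁿ⁺¹`
this is its rank as a free `ℤ`-module, which is what we record. [cite: KaloshinZhang2018, §1 l.316] -/
def rank (Λ : ResonanceLattice n) : ℕ := Module.finrank ℤ Λ.carrier

/-- **Irreducible** lattice (l.320, verbatim): "Λ is *irreducible* if it is not contained in any lattices of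
the same rank, or equivalently, Span_ℝ Λ ∩ ℤⁿ⁺¹ = Λ." Typed in the saturation form: an integer vector a non-zero
multiple of which lies in `Λ` lies in `Λ` (a rational point of the real span of integer vectors is a rational
combination of them, so the two readings agree; that equivalence is not re-proved here).
[cite: KaloshinZhang2018, §1 l.320] -/
def Irreducible (Λ : ResonanceLattice n) : Prop :=
  ∀ (k : IntVec n) (N : ℤ), N ≠ 0 → N • k ∈ Λ.carrier → k ∈ Λ.carrier

/-- `Λˢᵗ ⊂ Λ`. [cite: KaloshinZhang2018, §1 l.385] -/
def IsSublattice (Λst Λ : ResonanceLattice n) : Prop := Λst.carrier ≤ Λ.carrier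

/-- The **relative norm** `M(Λ|Λˢᵗ) := min_{k ∈ Λ ∖ Λˢᵗ} |k|` (eq. (relative-lattice-norm), l.385–391), valued in
`ℕ∞` (`⊤` when `Λ = Λˢᵗ`). "Λ admits a dominant structure if it contains an irreducible lattice Λˢᵗ of rank m < d,
such that M(Λ|Λˢᵗ) ≫ max_{k ∈ 𝓑ˢᵗ} |k|" — the "≫" is quantified in each theorem ("there exists M > 0 such that
for 𝔐 ≥ M …"), never as a definition, and so it is here. [cite: KaloshinZhang2018, §1 l.385–393] -/
def relNorm (Λ Λst : ResonanceLattice n) : ℕ∞ :=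
  ⨅ k ∈ {k : IntVec n | k ∈ Λ.carrier ∧ k ∉ Λst.carrier}, (supNorm k : ℕ∞)

/-- The resonance manifold `Γ_k = {p ∈ ℝⁿ : k · (ω(p), 1) = 0}`, `ω = ∂ₚH₀` (l.315–316), for a frequency map
`ω`. [cite: KaloshinZhang2018, §1 l.315–316] -/
def resonanceSurface (ω : (Fin n → ℝ) → (Fin n → ℝ)) (k : IntVec n) : Set (Fin n → ℝ) :=
  {p | ∑ j, (k j : ℝ) * freqExt (ω p) j = 0}

/-- `Γ_Λ = ⋂ {Γ_k : k ∈ Λ}` (l.317–320), "a co-dimension d submanifold of ℝⁿ, and in particular, an n-resonant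
submanifold is a single point". [cite: KaloshinZhang2018, §1 l.317–320] -/
def resonanceManifold (ω : (Fin n → ℝ) → (Fin n → ℝ)) (Λ : ResonanceLattice n) : Set (Fin n → ℝ) :=
  ⋂ k ∈ (Λ.carrier : Set (IntVec n)), resonanceSurface ω k

/-- The integer vectors resonant at a given action form a subgroup (the relation `k · (ω(p), 1) = 0` is linear
in `k`). [folklore] -/
def resonantAt (ω : (Fin n → ℝ) → (Fin n → ℝ)) (p : Fin n → ℝ) : Submodule ℤ (IntVec n) where
  carrier := {k | ∑ j, (k j : ℝ) * freqExt (ω p) j = 0}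
  zero_mem' := by simp
  add_mem' := by
    intro a b ha hb
    simp only [Set.mem_setOf_eq, Pi.add_apply, Int.cast_add, add_mul, Finset.sum_add_distrib] at ha hb ⊢
    rw [ha, hb, add_zero]
  smul_mem' := by
    intro c a ha
    simp only [Set.mem_setOf_eq, Pi.smul_apply, smul_eq_mul, Int.cast_mul, mul_assoc, ← Finset.mul_sum]
      at ha ⊢
    rw [ha, mul_zero]

/-- `p ∈ Γ_k ↔ k` is resonant at `p`. [folklore] -/
theorem mem_resonanceSurface_iff (ω : (Fin n → ℝ) → (Fin n → ℝ)) (k : IntVec n) (p : Fin n → ℝ) :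
    p ∈ resonanceSurface ω k ↔ k ∈ resonantAt ω p := Iff.rfl

/-- `Γ_Λ = ⋂_{i} Γ_{k_i}` for any family `k_i` SPANNING `Λ` (l.317–320: "= ⋂_{i=1}^d Γ_{k_i}, where {k₁, ⋯, k_d}
is any linear independent set in Λ" — for a basis this is the statement; linearity in `k` is all that is used).
[cite: KaloshinZhang2018, §1 l.317–320] -/
theorem resonanceManifold_eq_iInter_of_span {ι : Type*} (ω : (Fin n → ℝ) → (Fin n → ℝ))
    (Λ : ResonanceLattice n) (𝓑 : ι → IntVec n) (hspan : Submodule.span ℤ (Set.range 𝓑) = Λ.carrier) :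
    resonanceManifold ω Λ = ⋂ i, resonanceSurface ω (𝓑 i) := by
  ext p
  simp only [resonanceManifold, Set.mem_iInter, mem_resonanceSurface_iff, SetLike.mem_coe]
  constructor
  · intro h i
    exact h (𝓑 i) (hspan ▸ Submodule.subset_span (Set.mem_range_self i))
  · intro h k hk
    rw [← hspan] at hk
    have hle : Submodule.span ℤ (Set.range 𝓑) ≤ resonantAt ω p :=
      Submodule.span_le.mpr (by rintro _ ⟨i, rfl⟩; exact h i)
    exact hle hk

/-- An **ordered basis** `𝓑 = [k₁, ⋯, k_d]` of `Λ` over `ℤ` (l.343: "𝓑 = [k₁, ⋯, k_n] is an ordered basis over ℤ";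
l.367–368). [cite: KaloshinZhang2018, §1 l.343, l.367–368] -/
structure IsOrderedBasis (Λ : ResonanceLattice n) {d : ℕ} (𝓑 : Fin d → IntVec n) : Prop where
  /-- linear independence over `ℤ` -/
  linearIndependent : LinearIndependent ℤ 𝓑
  /-- `𝓑` generates `Λ` -/
  span_eq : Submodule.span ℤ (Set.range 𝓑) = Λ.carrier

/-- Members of an ordered basis lie in the lattice. [folklore] -/
theorem IsOrderedBasis.mem {Λ : ResonanceLattice n} {d : ℕ} {𝓑 : Fin d → IntVec n}
    (h : IsOrderedBasis Λ 𝓑) (i : Fin d) : 𝓑 i ∈ Λ.carrier :=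
  h.span_eq ▸ Submodule.subset_span (Set.mem_range_self i)

/-- An **adapted basis** for `Λˢᵗ ⊂ Λ` (l.391–393, verbatim): "one can choose an *adapted basis* 𝓑 = [k₁, ⋯, k_d]
of Λ, meaning that 𝓑ˢᵗ = [k₁, ⋯, k_m] is a properly ordered basis of Λˢᵗ"; we write `d = m + w` and
`𝓑 = Fin.append 𝓑ˢᵗ 𝓑ʷᵏ`, `𝓑ʷᵏ = [k₁ʷᵏ, ⋯, k_wʷᵏ]` (l.538–541). [cite: KaloshinZhang2018, §1 l.391–393, §2.1 l.536–541] -/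
structure IsAdaptedBasis (Λst Λ : ResonanceLattice n) {m w : ℕ} (𝓑st : Fin m → IntVec n)
    (𝓑wk : Fin w → IntVec n) : Prop where
  /-- `𝓑ˢᵗ` is an ordered basis of the strong lattice -/
  strong : IsOrderedBasis Λst 𝓑st
  /-- `[𝓑ˢᵗ, 𝓑ʷᵏ]` is an ordered basis of `Λ` -/
  whole : IsOrderedBasis Λ (Fin.append 𝓑st 𝓑wk)

end ResonanceLattice

/-! ### The kinetic energy `K_{p₀,𝓑}` (eq. (Kd)/(Kn)) and its Hessian blocks (eq. (ABC)) -/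

/-- The matrix whose rows are the SPACE parts `k̄₁, ⋯, k̄_d` of the basis vectors (real entries).
[cite: KaloshinZhang2018, §1 eq. (Kn) l.374–377] -/
def spaceRows {d : ℕ} (𝓑 : Fin d → IntVec n) : Matrix (Fin d) (Fin n) ℝ :=
  Matrix.of fun i l => (𝓑 i l.castSucc : ℝ)

/-- The matrix whose rows are the full basis vectors `k₁, ⋯, k_d ∈ ℤⁿ⁺¹` (real entries).
[cite: KaloshinZhang2018, §2.1 eq. (Kd) l.521–524] -/
def fullRows {d : ℕ} (𝓑 : Fin d → IntVec n) : Matrix (Fin d) (Fin (n + 1)) ℝ :=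
  Matrix.of fun i j => (𝓑 i j : ℝ)

/-- Unfolding of `spaceRows`. [folklore] -/
@[simp] theorem spaceRows_apply {d : ℕ} (𝓑 : Fin d → IntVec n) (i : Fin d) (l : Fin n) :
    spaceRows 𝓑 i l = (𝓑 i l.castSucc : ℝ) := rfl

/-- Unfolding of `fullRows`. [folklore] -/
@[simp] theorem fullRows_apply {d : ℕ} (𝓑 : Fin d → IntVec n) (i : Fin d) (j : Fin (n + 1)) :
    fullRows 𝓑 i j = (𝓑 i j : ℝ) := rfl

/-- `I₁k₁ + ⋯ + I_dk_d ∈ ℝⁿ⁺¹` is `I ᵥ* fullRows 𝓑`, and its space part is `I ᵥ* spaceRows 𝓑 = I₁k̄₁ + ⋯ + I_dk̄_d`.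
[cite: KaloshinZhang2018, §1 eq. (Kn) l.374–377, §2.1 eq. (Kd) l.521–524] -/
theorem spacePart_vecMul_fullRows {d : ℕ} (𝓑 : Fin d → IntVec n) (I : Fin d → ℝ) :
    spacePart (I ᵥ* fullRows 𝓑) = I ᵥ* spaceRows 𝓑 := by
  funext l
  simp [Matrix.vecMul, dotProduct]

/-- The PADDED Hessian `Q(p) = [[Q₀(p), 0], [0, 0]] ∈ Sym(n+1)` (eq. (quadratic-form) l.517–520; l.630: "Define as
before Q(p) = [Q₀(p) 0; 0 0]"), the `(n+1) × (n+1)` matrix through which the paper pairs full frequency vectors.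
[cite: KaloshinZhang2018, §2.1 eq. (quadratic-form) l.517–520, §2.2 l.630] -/
def padQ (Q₀ : Matrix (Fin n) (Fin n) ℝ) : Matrix (Fin (n + 1)) (Fin (n + 1)) ℝ :=
  Matrix.of fun i j =>
    Fin.lastCases (0 : ℝ) (fun i' : Fin n => Fin.lastCases (0 : ℝ) (fun j' : Fin n => Q₀ i' j') j) i

/-- Entries of the padded Hessian on space indices. [folklore] -/
@[simp] theorem padQ_castSucc_castSucc (Q₀ : Matrix (Fin n) (Fin n) ℝ) (i j : Fin n) :
    padQ Q₀ i.castSucc j.castSucc = Q₀ i j := by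
  simp [padQ]

/-- The padded Hessian vanishes on the time row. [folklore] -/
@[simp] theorem padQ_last_left (Q₀ : Matrix (Fin n) (Fin n) ℝ) (j : Fin (n + 1)) :
    padQ Q₀ (Fin.last n) j = 0 := by
  simp [padQ]

/-- The padded Hessian vanishes on the time column. [folklore] -/
@[simp] theorem padQ_castSucc_last (Q₀ : Matrix (Fin n) (Fin n) ℝ) (i : Fin n) :
    padQ Q₀ i.castSucc (Fin.last n) = 0 := by
  simp [padQ]

/-- **(Kd) = (Kn)**: the padded form only sees space parts, `x · Q y = x̄ · Q₀ ȳ`.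
[cite: KaloshinZhang2018, §1 eq. (Kn) l.374–377, §2.1 eq. (Kd) l.521–524] -/
theorem dotProduct_padQ_mulVec (Q₀ : Matrix (Fin n) (Fin n) ℝ) (x y : Fin (n + 1) → ℝ) :
    x ⬝ᵥ (padQ Q₀ *ᵥ y) = spacePart x ⬝ᵥ (Q₀ *ᵥ spacePart y) := by
  simp [dotProduct, Matrix.mulVec, Fin.sum_univ_castSucc]

/-- The Hessian `∂²_{II} K_{p₀,𝓑}` as a `d × d` matrix: `(∂²K)_{ij} = k̄ᵢ · Q₀ k̄ⱼ = kᵢᵀ Q kⱼ` — for an adapted basis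
these are the blocks `A`, `B`, `Bᵀ`, `C` of eq. (ABC). [cite: KaloshinZhang2018, §2.3 eq. (block-ABC)–(ABC) l.699–711] -/
def hessK (Q₀ : Matrix (Fin n) (Fin n) ℝ) {d : ℕ} (𝓑 : Fin d → IntVec n) : Matrix (Fin d) (Fin d) ℝ :=
  spaceRows 𝓑 * Q₀ * (spaceRows 𝓑)ᵀ

/-- **(ABC)** entrywise: `(∂²K)_{ij} = k̄ᵢ · Q₀ k̄ⱼ`. [cite: KaloshinZhang2018, §2.3 eq. (ABC) l.708–711] -/
theorem hessK_apply (Q₀ : Matrix (Fin n) (Fin n) ℝ) {d : ℕ} (𝓑 : Fin d → IntVec n) (i j : Fin d) :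
    hessK Q₀ 𝓑 i j = spaceRows 𝓑 i ⬝ᵥ (Q₀ *ᵥ spaceRows 𝓑 j) := by
  simp only [hessK, Matrix.mul_apply, Matrix.transpose_apply, dotProduct, Matrix.mulVec, Finset.sum_mul]
  rw [Finset.sum_comm]
  refine Finset.sum_congr rfl fun l _ => ?_
  rw [Finset.mul_sum]
  refine Finset.sum_congr rfl fun l' _ => ?_
  ring

/-- **The kinetic energy** `K_{p₀,𝓑}(I) = ½ ∂²ₚₚH₀(p₀)(I₁k̄₁ + ⋯ + I_dk̄_d) · (I₁k̄₁ + ⋯ + I_dk̄_d)` (eq. (Kn), l.374–377),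
written as `½ I · (∂²K) I`; `Q₀ = ∂²ₚₚH₀(p₀)`. [cite: KaloshinZhang2018, §1 eq. (slow-system)–(Kn) l.366–377] -/
def kinetic (Q₀ : Matrix (Fin n) (Fin n) ℝ) {d : ℕ} (𝓑 : Fin d → IntVec n) (I : Fin d → ℝ) : ℝ :=
  (1 / 2) * (I ⬝ᵥ (hessK Q₀ 𝓑 *ᵥ I))

/-- **(Kn)**: `K(I) = ½ Q₀ x̄ · x̄` with `x̄ = I₁k̄₁ + ⋯ + I_dk̄_d`. [cite: KaloshinZhang2018, §1 eq. (Kn) l.374–377] -/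
theorem kinetic_eq_space (Q₀ : Matrix (Fin n) (Fin n) ℝ) {d : ℕ} (𝓑 : Fin d → IntVec n) (I : Fin d → ℝ) :
    kinetic Q₀ 𝓑 I = (1 / 2) * ((I ᵥ* spaceRows 𝓑) ⬝ᵥ (Q₀ *ᵥ (I ᵥ* spaceRows 𝓑))) := by
  unfold kinetic hessK
  rw [← Matrix.mulVec_mulVec, ← Matrix.mulVec_mulVec, Matrix.mulVec_transpose, Matrix.dotProduct_mulVec]

/-- **(Kd)**: `K(I) = ½ Q(p₀)(I₁k₁ + ⋯ + I_dk_d) · (I₁k₁ + ⋯ + I_dk_d)` with the padded `Q` — equal to (Kn)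
("then (Kn) becomes (Kd)", l.521). [cite: KaloshinZhang2018, §2.1 eq. (Kd) l.521–524] -/
theorem kinetic_eq_padded (Q₀ : Matrix (Fin n) (Fin n) ℝ) {d : ℕ} (𝓑 : Fin d → IntVec n) (I : Fin d → ℝ) :
    kinetic Q₀ 𝓑 I = (1 / 2) * ((I ᵥ* fullRows 𝓑) ⬝ᵥ (padQ Q₀ *ᵥ (I ᵥ* fullRows 𝓑))) := by
  rw [dotProduct_padQ_mulVec, spacePart_vecMul_fullRows, kinetic_eq_space]

/-- `∂²K = M Q₀ Mᵀ` is positive definite when `Q₀` is and the space rows `k̄ᵢ` are linearly independent over `ℝ`.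
[cite: KaloshinZhang2018, §1 l.307–310 (D⁻¹ Id ≤ ∂²ₚₚH₀ ≤ D Id), eq. (Kn) l.374–377] -/
theorem hessK_posDef {Q₀ : Matrix (Fin n) (Fin n) ℝ} (hQ : Q₀.PosDef) {d : ℕ} {𝓑 : Fin d → IntVec n}
    (hli : LinearIndependent ℝ (spaceRows 𝓑).row) : (hessK Q₀ 𝓑).PosDef := by
  have hinj : Function.Injective (spaceRows 𝓑).vecMul := Matrix.vecMul_injective_iff.mpr hli
  have h := hQ.mul_mul_conjTranspose_same (B := spaceRows 𝓑) hinj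
  simpa [hessK, Matrix.conjTranspose_eq_transpose_of_trivial] using h

namespace ResonanceLattice

/-- **The lattice axiom at work.** If `k₁, ⋯, k_d` lie in a resonance lattice and are linearly independent over
`ℤ`, then their SPACE parts `k̄₁, ⋯, k̄_d ∈ ℝⁿ` are linearly independent over `ℝ`. (Proof: the integer Gram matrix
`G = (k̄ᵢ · k̄ⱼ)` is non-singular — a kernel vector `v ∈ ℤᵈ` (ℤ is a domain) gives `|Σ vᵢk̄ᵢ|² = vᵀGv = 0`, so
`Σ vᵢkᵢ` has zero space part, hence is `0` by the lattice axiom, hence `v = 0`; and a real matrix with non-zero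
integer Gram determinant has independent rows.) [cite: KaloshinZhang2018, §1 l.316, eq. (Kn) l.374–377] -/
theorem linearIndependent_spaceRows (Λ : ResonanceLattice n) {d : ℕ} {𝓑 : Fin d → IntVec n}
    (hmem : ∀ i, 𝓑 i ∈ Λ.carrier) (hli : LinearIndependent ℤ 𝓑) :
    LinearIndependent ℝ (spaceRows 𝓑).row := by
  classical
  -- integer space rows and their Gram matrix
  let S : Matrix (Fin d) (Fin n) ℤ := Matrix.of fun i l => 𝓑 i l.castSucc
  let G : Matrix (Fin d) (Fin d) ℤ := S * Sᵀ
  have hGdet : G.det ≠ 0 := by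
    intro hdet
    obtain ⟨v, hv, hGv⟩ := Matrix.exists_mulVec_eq_zero_iff.mpr hdet
    have hw : (v ᵥ* S) ⬝ᵥ (v ᵥ* S) = 0 := by
      have h0 : v ⬝ᵥ (G *ᵥ v) = 0 := by rw [hGv, dotProduct_zero]
      rwa [← Matrix.mulVec_mulVec, Matrix.mulVec_transpose, Matrix.dotProduct_mulVec] at h0
    have hw0 : v ᵥ* S = 0 := dotProduct_self_eq_zero.mp hw
    have hcomb : spacePart (∑ i, v i • 𝓑 i) = 0 := by
      funext l
      have := congrFun hw0 l
      simpa [Matrix.vecMul, dotProduct, S, Finset.sum_apply, mul_comm] using this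
    have hmemc : (∑ i, v i • 𝓑 i) ∈ Λ.carrier :=
      Submodule.sum_mem _ fun i _ => Submodule.smul_mem _ _ (hmem i)
    have hzero : (∑ i, v i • 𝓑 i) = 0 := Λ.no_temporal _ hmemc hcomb
    exact hv (funext fun i => Fintype.linearIndependent_iff.mp hli v hzero i)
  -- pass to `ℝ`
  have hSR : spaceRows 𝓑 = S.map (Int.castRingHom ℝ) := by
    ext i l; simp [S]
  have hGR : (spaceRows 𝓑 * (spaceRows 𝓑)ᵀ) = G.map (Int.castRingHom ℝ) := by
    rw [hSR, Matrix.map_mul, Matrix.transpose_map]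
  have hGRdet : (spaceRows 𝓑 * (spaceRows 𝓑)ᵀ).det ≠ 0 := by
    rw [hGR]
    have : ((G.det : ℤ) : ℝ) = (G.map (Int.castRingHom ℝ)).det := by
      rw [Int.cast_det]; rfl
    rw [← this]
    exact_mod_cast hGdet
  have hGRunit : IsUnit (spaceRows 𝓑 * (spaceRows 𝓑)ᵀ) := by
    rw [Matrix.isUnit_iff_isUnit_det]
    exact isUnit_iff_ne_zero.mpr hGRdet
  have hGinj : Function.Injective (spaceRows 𝓑 * (spaceRows 𝓑)ᵀ).vecMul :=
    Matrix.vecMul_injective_iff_isUnit.mpr hGRunit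
  rw [← Matrix.vecMul_injective_iff]
  intro c c' h
  apply hGinj
  change c ᵥ* (spaceRows 𝓑 * (spaceRows 𝓑)ᵀ) = c' ᵥ* (spaceRows 𝓑 * (spaceRows 𝓑)ᵀ)
  rw [← Matrix.vecMul_vecMul, ← Matrix.vecMul_vecMul]
  exact congrArg (fun x => x ᵥ* (spaceRows 𝓑)ᵀ) h

/-- **The slow system at any `d`-resonance is a genuine mechanical system**: for `k₁, ⋯, k_d` independent in a
resonance lattice and `Q₀ = ∂²ₚₚH₀(p₀) > 0` (the standing convexity assumption `D⁻¹ Id ≤ ∂²ₚₚH₀ ≤ D Id`, l.307–310),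
`K_{p₀,𝓑}` is a positive definite quadratic form on `ℝᵈ`. [cite: KaloshinZhang2018, §1 l.307–310, l.316, eq. (Kn) l.374–377] -/
theorem hessK_posDef_of_mem (Λ : ResonanceLattice n) {Q₀ : Matrix (Fin n) (Fin n) ℝ} (hQ : Q₀.PosDef)
    {d : ℕ} {𝓑 : Fin d → IntVec n} (hmem : ∀ i, 𝓑 i ∈ Λ.carrier) (hli : LinearIndependent ℤ 𝓑) :
    (hessK Q₀ 𝓑).PosDef :=
  hessK_posDef hQ (Λ.linearIndependent_spaceRows hmem hli)

end ResonanceLattice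

/-! ### The Fourier restriction `Z_𝓑` (eq. (ZB)) and the strong/weak splitting of the potential -/

/-- **(ZB) at coefficient level**: the Fourier coefficient of `Z_𝓑(φ₁, ⋯, φ_d, p)` at `l ∈ ℤᵈ` is
`h_{l₁k₁ + ⋯ + l_dk_d}(p)` (l.526–529: `Z_𝓑 = Σ_{l ∈ ℤᵈ} h_{l₁k₁+⋯+l_dk_d}(p) e^{2πi(l₁φ₁+⋯+l_dφ_d)}`), and
`U_{p₀,𝓑} = −Z_𝓑(·, p₀)` (l.531–533). Here `h : ℤⁿ⁺¹ → E` is the coefficient table of `H₁(·, p, ·)`; the series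
itself is `KaloshinZhang2020.SlowSystemShapes.resonantTrigPoly` in the frame language.
[cite: KaloshinZhang2018, §2.1 eq. (ZB) l.525–533] -/
def ZBcoeff {E : Type*} (h : IntVec n → E) {d : ℕ} (𝓑 : Fin d → IntVec n) (l : Fin d → ℤ) : E :=
  h (∑ i, l i • 𝓑 i)

/-- The strong potential is the restriction of `Z_𝓑` to `l = (lˢᵗ, 0)`: for an adapted basis,
`Z_{[𝓑ˢᵗ,𝓑ʷᵏ]}` at `(lˢᵗ, 0)` is `Z_{𝓑ˢᵗ}` at `lˢᵗ` — whence `U^{wk} = −(Z_𝓑 − Z_{𝓑ˢᵗ})` collects exactly the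
coefficients with `lʷᵏ ≠ 0` (l.549–557). [cite: KaloshinZhang2018, §2.1 l.549–557] -/
theorem ZBcoeff_append_zero {E : Type*} (h : IntVec n → E) {m w : ℕ} (𝓑st : Fin m → IntVec n)
    (𝓑wk : Fin w → IntVec n) (lst : Fin m → ℤ) :
    ZBcoeff h (Fin.append 𝓑st 𝓑wk) (Fin.append lst (0 : Fin w → ℤ)) = ZBcoeff h 𝓑st lst := by
  unfold ZBcoeff
  congr 1
  rw [Fin.sum_univ_add]
  simp

/-! ### Strong and weak blocks: `Kˢᵗ(Iˢᵗ) = Kˢ(Iˢᵗ, 0)` and `∂²K = [[A, B], [Bᵀ, C]]` -/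

section Blocks

variable {m w : ℕ}

/-- `(M₁ Q₀ M₂ᵀ)_{ij} = (row i of M₁) · Q₀ (row j of M₂)`. [folklore] -/
theorem mul_mul_transpose_apply {a b : ℕ} (M₁ : Matrix (Fin a) (Fin n) ℝ) (Q₀ : Matrix (Fin n) (Fin n) ℝ)
    (M₂ : Matrix (Fin b) (Fin n) ℝ) (i : Fin a) (j : Fin b) :
    (M₁ * Q₀ * M₂ᵀ) i j = M₁ i ⬝ᵥ (Q₀ *ᵥ M₂ j) := by
  simp only [Matrix.mul_apply, Matrix.transpose_apply, dotProduct, Matrix.mulVec, Finset.sum_mul]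
  rw [Finset.sum_comm]
  refine Finset.sum_congr rfl fun l _ => ?_
  rw [Finset.mul_sum]
  refine Finset.sum_congr rfl fun l' _ => ?_
  ring

/-- Space rows of `[𝓑ˢᵗ, 𝓑ʷᵏ]`: the strong ones. [folklore] -/
@[simp] theorem spaceRows_append_castAdd (𝓑st : Fin m → IntVec n) (𝓑wk : Fin w → IntVec n) (i : Fin m) :
    spaceRows (Fin.append 𝓑st 𝓑wk) (Fin.castAdd w i) = spaceRows 𝓑st i := by
  funext l; simp

/-- Space rows of `[𝓑ˢᵗ, 𝓑ʷᵏ]`: the weak ones. [folklore] -/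
@[simp] theorem spaceRows_append_natAdd (𝓑st : Fin m → IntVec n) (𝓑wk : Fin w → IntVec n) (j : Fin w) :
    spaceRows (Fin.append 𝓑st 𝓑wk) (Fin.natAdd m j) = spaceRows 𝓑wk j := by
  funext l; simp

/-- `(Iˢᵗ, Iʷᵏ) ↦ Iˢᵗ₁k̄₁ + ⋯`: the space combination splits into strong and weak parts. [folklore] -/
theorem append_vecMul_spaceRows (𝓑st : Fin m → IntVec n) (𝓑wk : Fin w → IntVec n) (Ist : Fin m → ℝ)
    (Iwk : Fin w → ℝ) :
    Fin.append Ist Iwk ᵥ* spaceRows (Fin.append 𝓑st 𝓑wk) = Ist ᵥ* spaceRows 𝓑st + Iwk ᵥ* spaceRows 𝓑wk := by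
  funext l
  simp [Matrix.vecMul, dotProduct, Fin.sum_univ_add]

/-- **`Kˢᵗ(I₁, ⋯, I_m) = Kˢ(I₁, ⋯, I_m, 0, ⋯, 0)`** (eq. (comp-slow-st) l.402–405; l.561–564 "the second line
follows directly from (Kd)"; l.678–682: `𝓗ˢᵗ(p₀, Uˢᵗ) = K_{p₀,𝓑ˢᵗ,𝓑ʷᵏ}(Iˢᵗ, 0) − Uˢᵗ(φˢᵗ)`): the strong system's kinetic
energy is the slow one on the strong actions. [cite: KaloshinZhang2018, §1 l.402–405, §2.1 l.561–564, §2.2 l.678–682] -/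
theorem kinetic_append_zero (Q₀ : Matrix (Fin n) (Fin n) ℝ) (𝓑st : Fin m → IntVec n)
    (𝓑wk : Fin w → IntVec n) (Ist : Fin m → ℝ) :
    kinetic Q₀ (Fin.append 𝓑st 𝓑wk) (Fin.append Ist (0 : Fin w → ℝ)) = kinetic Q₀ 𝓑st Ist := by
  rw [kinetic_eq_space, kinetic_eq_space, append_vecMul_spaceRows, Matrix.zero_vecMul, add_zero]

/-- The off-diagonal block `B_{ij} = (kᵢˢᵗ)ᵀ Q kⱼʷᵏ = k̄ᵢˢᵗ · Q₀ k̄ⱼʷᵏ` of eq. (ABC); the diagonal blocks are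
`A = hessK Q₀ 𝓑ˢᵗ` ("note in particular that A = ∂²_{IˢᵗIˢᵗ}Hˢᵗ", l.712) and `C = hessK Q₀ 𝓑ʷᵏ`.
[cite: KaloshinZhang2018, §2.3 eq. (ABC) l.708–712] -/
def blockB (Q₀ : Matrix (Fin n) (Fin n) ℝ) (𝓑st : Fin m → IntVec n) (𝓑wk : Fin w → IntVec n) :
    Matrix (Fin m) (Fin w) ℝ :=
  spaceRows 𝓑st * Q₀ * (spaceRows 𝓑wk)ᵀ

/-- `B_{ij} = k̄ᵢˢᵗ · Q₀ k̄ⱼʷᵏ`. [cite: KaloshinZhang2018, §2.3 eq. (ABC) l.708–711] -/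
theorem blockB_apply (Q₀ : Matrix (Fin n) (Fin n) ℝ) (𝓑st : Fin m → IntVec n) (𝓑wk : Fin w → IntVec n)
    (i : Fin m) (j : Fin w) :
    blockB Q₀ 𝓑st 𝓑wk i j = spaceRows 𝓑st i ⬝ᵥ (Q₀ *ᵥ spaceRows 𝓑wk j) :=
  mul_mul_transpose_apply _ _ _ i j

/-- Upper-left block of `∂²K` for `[𝓑ˢᵗ, 𝓑ʷᵏ]` is `A = ∂²Kˢᵗ`. [cite: KaloshinZhang2018, §2.3 eq. (block-ABC) l.699–712] -/
theorem hessK_append_castAdd_castAdd (Q₀ : Matrix (Fin n) (Fin n) ℝ) (𝓑st : Fin m → IntVec n)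
    (𝓑wk : Fin w → IntVec n) (i j : Fin m) :
    hessK Q₀ (Fin.append 𝓑st 𝓑wk) (Fin.castAdd w i) (Fin.castAdd w j) = hessK Q₀ 𝓑st i j := by
  rw [hessK_apply, hessK_apply, spaceRows_append_castAdd, spaceRows_append_castAdd]

/-- Upper-right block of `∂²K` is `B`. [cite: KaloshinZhang2018, §2.3 eq. (block-ABC) l.699–711] -/
theorem hessK_append_castAdd_natAdd (Q₀ : Matrix (Fin n) (Fin n) ℝ) (𝓑st : Fin m → IntVec n)
    (𝓑wk : Fin w → IntVec n) (i : Fin m) (j : Fin w) :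
    hessK Q₀ (Fin.append 𝓑st 𝓑wk) (Fin.castAdd w i) (Fin.natAdd m j) = blockB Q₀ 𝓑st 𝓑wk i j := by
  rw [hessK_apply, blockB_apply, spaceRows_append_castAdd, spaceRows_append_natAdd]

/-- Lower-left block of `∂²K` is `Bᵀ` — this uses the symmetry of `Q₀ = ∂²ₚₚH₀` (`Q₀ ∈ Sym(n)`, l.517).
[cite: KaloshinZhang2018, §2.3 eq. (block-ABC) l.699–711] -/
theorem hessK_append_natAdd_castAdd {Q₀ : Matrix (Fin n) (Fin n) ℝ} (hQ : Q₀.IsSymm)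
    (𝓑st : Fin m → IntVec n) (𝓑wk : Fin w → IntVec n) (j : Fin w) (i : Fin m) :
    hessK Q₀ (Fin.append 𝓑st 𝓑wk) (Fin.natAdd m j) (Fin.castAdd w i) = blockB Q₀ 𝓑st 𝓑wk i j := by
  rw [hessK_apply, blockB_apply, spaceRows_append_castAdd, spaceRows_append_natAdd,
    Matrix.dotProduct_mulVec (spaceRows 𝓑wk j) Q₀, ← Matrix.mulVec_transpose, hQ.eq, dotProduct_comm]

/-- Lower-right block of `∂²K` is `C = hessK Q₀ 𝓑ʷᵏ`. [cite: KaloshinZhang2018, §2.3 eq. (block-ABC) l.699–711] -/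
theorem hessK_append_natAdd_natAdd (Q₀ : Matrix (Fin n) (Fin n) ℝ) (𝓑st : Fin m → IntVec n)
    (𝓑wk : Fin w → IntVec n) (i j : Fin w) :
    hessK Q₀ (Fin.append 𝓑st 𝓑wk) (Fin.natAdd m i) (Fin.natAdd m j) = hessK Q₀ 𝓑wk i j := by
  rw [hessK_apply, hessK_apply, spaceRows_append_natAdd, spaceRows_append_natAdd]

/-- A dot product against an appended vector splits into strong and weak sums. [folklore] -/
theorem append_dotProduct (x : Fin m → ℝ) (y : Fin w → ℝ) (z : Fin (m + w) → ℝ) :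
    Fin.append x y ⬝ᵥ z = x ⬝ᵥ (fun i => z (Fin.castAdd w i)) + y ⬝ᵥ (fun j => z (Fin.natAdd m j)) := by
  simp [dotProduct, Fin.sum_univ_add]

/-- **`φ̇ˢᵗ = ∂_{Iˢᵗ}K = A Iˢᵗ + B Iʷᵏ`** (the Hamiltonian equation of `Hˢ`, l.712–718): strong components of
`(∂²K)(Iˢᵗ, Iʷᵏ)`. [cite: KaloshinZhang2018, §2.3 l.712–718] -/
theorem hessK_append_mulVec_strong (Q₀ : Matrix (Fin n) (Fin n) ℝ) (𝓑st : Fin m → IntVec n)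
    (𝓑wk : Fin w → IntVec n) (Ist : Fin m → ℝ) (Iwk : Fin w → ℝ) :
    (fun i => (hessK Q₀ (Fin.append 𝓑st 𝓑wk) *ᵥ Fin.append Ist Iwk) (Fin.castAdd w i))
      = hessK Q₀ 𝓑st *ᵥ Ist + blockB Q₀ 𝓑st 𝓑wk *ᵥ Iwk := by
  funext i
  simp only [Matrix.mulVec, dotProduct, Pi.add_apply, Fin.sum_univ_add, Fin.append_left, Fin.append_right,
    hessK_append_castAdd_castAdd, hessK_append_castAdd_natAdd]

/-- **`φ̇ʷᵏ = ∂_{Iʷᵏ}K = Bᵀ Iˢᵗ + C Iʷᵏ`** (l.712–718; `Q₀` symmetric): weak components of `(∂²K)(Iˢᵗ, Iʷᵏ)`.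
[cite: KaloshinZhang2018, §2.3 l.712–718] -/
theorem hessK_append_mulVec_weak {Q₀ : Matrix (Fin n) (Fin n) ℝ} (hQ : Q₀.IsSymm)
    (𝓑st : Fin m → IntVec n) (𝓑wk : Fin w → IntVec n) (Ist : Fin m → ℝ) (Iwk : Fin w → ℝ) :
    (fun j => (hessK Q₀ (Fin.append 𝓑st 𝓑wk) *ᵥ Fin.append Ist Iwk) (Fin.natAdd m j))
      = (blockB Q₀ 𝓑st 𝓑wk)ᵀ *ᵥ Ist + hessK Q₀ 𝓑wk *ᵥ Iwk := by
  funext j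
  simp only [Matrix.mulVec, dotProduct, Pi.add_apply, Fin.sum_univ_add, Fin.append_left, Fin.append_right,
    hessK_append_natAdd_castAdd hQ, hessK_append_natAdd_natAdd, Matrix.transpose_apply]

end Blocks

/-! ### Block algebra of `∂²K = [[A, B], [Bᵀ, C]]`: half-Lagrangian coordinates, `C̃`, `c̄`, Lemma 5.1

The statements of this section are about three real matrices `A` (`m × m`), `B` (`m × w`), `C` (`w × w`); for
the slow system they are the blocks of `∂²K` (`kinetic_append_eq_Kblock`). -/

namespace BlockForm

variable {m w : ℕ} (A : Matrix (Fin m) (Fin m) ℝ) (B : Matrix (Fin m) (Fin w) ℝ) (C : Matrix (Fin w) (Fin w) ℝ)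

/-- `vˢᵗ = A Iˢᵗ + B Iʷᵏ` (l.738–741). [cite: KaloshinZhang2018, §2.3 l.738–741] -/
def vSt (Ist : Fin m → ℝ) (Iwk : Fin w → ℝ) : Fin m → ℝ := A *ᵥ Ist + B *ᵥ Iwk

/-- `vʷᵏ = Bᵀ Iˢᵗ + C Iʷᵏ` (l.738–741, where the arXiv text prints "Bᵀ Iʷᵏ + C Iʷᵏ"; `Bᵀ Iˢᵗ` is forced by
l.712–718 and eq. (Hs-Lag) l.719–725). [cite: KaloshinZhang2018, §2.3 l.738–741] -/
def vWk (Ist : Fin m → ℝ) (Iwk : Fin w → ℝ) : Fin w → ℝ := Bᵀ *ᵥ Ist + C *ᵥ Iwk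

/-- `C̃ = C − Bᵀ A⁻¹ B`, "an invertible symmetric matrix" (l.746; l.1468).
[cite: KaloshinZhang2018, §2.3 l.746, Lemma 5.1 l.1466–1468] -/
def schurC : Matrix (Fin w) (Fin w) ℝ := C - Bᵀ * A⁻¹ * B

/-- `K` in block form: `K(Iˢᵗ, Iʷᵏ) = ½ Iˢᵗ·A Iˢᵗ + Iˢᵗ·B Iʷᵏ + ½ Iʷᵏ·C Iʷᵏ`.
[cite: KaloshinZhang2018, §2.3 eq. (block-ABC) l.699–706] -/
def Kblock (Ist : Fin m → ℝ) (Iwk : Fin w → ℝ) : ℝ :=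
  (1 / 2) * (Ist ⬝ᵥ (A *ᵥ Ist)) + Ist ⬝ᵥ (B *ᵥ Iwk) + (1 / 2) * (Iwk ⬝ᵥ (C *ᵥ Iwk))

/-- `c̄ = cˢᵗ + A⁻¹ B cʷᵏ` (eq. (c-bar), l.1470–1473). [cite: KaloshinZhang2018, Lemma 5.1 eq. (c-bar) l.1470–1473] -/
def cbar (cst : Fin m → ℝ) (cwk : Fin w → ℝ) : Fin m → ℝ := cst + A⁻¹ *ᵥ (B *ᵥ cwk)

variable {A B C}

/-- For a symmetric matrix the bilinear pairing is symmetric. [folklore] -/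
theorem dotProduct_mulVec_symm {k : ℕ} {S : Matrix (Fin k) (Fin k) ℝ} (hS : S.IsSymm) (x y : Fin k → ℝ) :
    x ⬝ᵥ (S *ᵥ y) = y ⬝ᵥ (S *ᵥ x) := by
  rw [Matrix.dotProduct_mulVec x S, ← Matrix.mulVec_transpose, hS.eq, dotProduct_comm]

/-- **The half-Lagrangian identity** (l.742–746): eliminating `Iˢᵗ` from `vˢᵗ = A Iˢᵗ + B Iʷᵏ`,
`vʷᵏ = Bᵀ Iˢᵗ + C Iʷᵏ` gives `vʷᵏ = Bᵀ A⁻¹ vˢᵗ + C̃ Iʷᵏ`. The arXiv text (l.744 and eq. (Xs) l.751) prints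
`− C̃ Iʷᵏ`; §4 l.1263 instead defines the coordinate by `C̃ Iʷᵏ = BᵀA⁻¹vˢᵗ − vʷᵏ`, i.e. uses `−Iʷᵏ`. With `Iʷᵏ` the
action variable of l.712–718 the sign is `+`, as checked here (immaterial for the norms in Theorem 2.2).
[cite: KaloshinZhang2018, §2.3 l.738–751, §4 l.1263] -/
theorem vWk_eq_halfLagrangian (hA : IsUnit A.det) (Ist : Fin m → ℝ) (Iwk : Fin w → ℝ) :
    vWk B C Ist Iwk = Bᵀ *ᵥ (A⁻¹ *ᵥ vSt A B Ist Iwk) + schurC A B C *ᵥ Iwk := by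
  have h1 : A⁻¹ *ᵥ (A *ᵥ Ist) = Ist := by
    rw [Matrix.mulVec_mulVec, Matrix.nonsing_inv_mul _ hA, Matrix.one_mulVec]
  have h2 : (Bᵀ * A⁻¹ * B) *ᵥ Iwk = Bᵀ *ᵥ (A⁻¹ *ᵥ (B *ᵥ Iwk)) := by
    rw [Matrix.mulVec_mulVec, Matrix.mulVec_mulVec]
  unfold vWk vSt schurC
  rw [Matrix.mulVec_add, Matrix.mulVec_add, h1, Matrix.sub_mulVec, h2]
  abel

/-- `A c̄ = A cˢᵗ + B cʷᵏ = (∂²K c)ˢᵗ`: `c̄` is the strong action carrying the strong velocity of `c`.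
[cite: KaloshinZhang2018, Lemma 5.1 eq. (c-bar) l.1470–1473] -/
theorem mulVec_cbar (hA : IsUnit A.det) (cst : Fin m → ℝ) (cwk : Fin w → ℝ) :
    A *ᵥ cbar A B cst cwk = vSt A B cst cwk := by
  unfold cbar vSt
  rw [Matrix.mulVec_add, Matrix.mulVec_mulVec, Matrix.mul_nonsing_inv _ hA, Matrix.one_mulVec]

/-- **Energy form of Lemma 5.1 / Proposition 5.3 at `U ≡ 0`**: `K(cˢᵗ, cʷᵏ) = ½ c̄ · A c̄ + ½ cʷᵏ · C̃ cʷᵏ`, i.e.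
`α_{Hˢ}(c) = α_{Hˢᵗ}(c̄) + ½ cʷᵏ · C̃ cʷᵏ` for the integrable slow system (l.966: "α_{Hˢ}(c) − ‖Uʷᵏ‖ ≤ α_{Hˢᵗ}(c̄)
+ ½ cʷᵏ·C̃cʷᵏ ≤ α_{Hˢ}(c) + ‖Uʷᵏ‖"). This decides between the two signs printed in arXiv v2 (l.961 vs l.1478;
l.1885 vs l.1893–1900): the "− ½ cʷᵏ·C̃cʷᵏ" of Lemma 5.1 (2) is the consistent one.
[cite: KaloshinZhang2018, §2.4 l.958–967, Lemma 5.1 l.1476–1479, Prop. 5.3 l.1882–1900] -/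
theorem Kblock_eq_strong_add_schur (hAs : A.IsSymm) (hA : IsUnit A.det)
    (cst : Fin m → ℝ) (cwk : Fin w → ℝ) :
    Kblock A B C cst cwk
      = (1 / 2) * (cbar A B cst cwk ⬝ᵥ (A *ᵥ cbar A B cst cwk))
        + (1 / 2) * (cwk ⬝ᵥ (schurC A B C *ᵥ cwk)) := by
  set u := A⁻¹ *ᵥ (B *ᵥ cwk) with hu
  have hAu : A *ᵥ u = B *ᵥ cwk := by
    rw [hu, Matrix.mulVec_mulVec, Matrix.mul_nonsing_inv _ hA, Matrix.one_mulVec]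
  have hcbar : cbar A B cst cwk = cst + u := rfl
  have e1 : u ⬝ᵥ (A *ᵥ cst) = cst ⬝ᵥ (B *ᵥ cwk) := by
    rw [dotProduct_mulVec_symm hAs, hAu]
  have e2 : cwk ⬝ᵥ (schurC A B C *ᵥ cwk) = cwk ⬝ᵥ (C *ᵥ cwk) - (B *ᵥ cwk) ⬝ᵥ u := by
    rw [schurC, Matrix.sub_mulVec, dotProduct_sub, ← Matrix.mulVec_mulVec, ← Matrix.mulVec_mulVec, ← hu,
      Matrix.dotProduct_mulVec cwk Bᵀ, Matrix.vecMul_transpose]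
  rw [Kblock, hcbar, add_dotProduct, Matrix.mulVec_add, dotProduct_add, dotProduct_add, hAu, e1, e2,
    dotProduct_comm u (B *ᵥ cwk)]
  ring

/-- **Lemma 5.1 (1) in the action parametrisation** (`v = ∂K(I)`, so `L₀ˢ(v) = K(I)`, `vˢᵗ = A Iˢᵗ + B Iʷᵏ` and
`w = vʷᵏ − BᵀA⁻¹vˢᵗ = C̃ Iʷᵏ`): `L₀ˢ(v) = ½ vˢᵗ·A⁻¹vˢᵗ + ½ w·C̃⁻¹w = L₀ˢᵗ(vˢᵗ) + ½ Iʷᵏ·C̃ Iʷᵏ` (l.1489–1491).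
[cite: KaloshinZhang2018, Lemma 5.1 (1) eq. (Ls-split) l.1461–1468, proof l.1484–1491] -/
theorem lemma51_energy (hAs : A.IsSymm) (hA : IsUnit A.det)
    (Ist : Fin m → ℝ) (Iwk : Fin w → ℝ) :
    Kblock A B C Ist Iwk
      = (1 / 2) * (vSt A B Ist Iwk ⬝ᵥ (A⁻¹ *ᵥ vSt A B Ist Iwk))
        + (1 / 2) * (Iwk ⬝ᵥ (schurC A B C *ᵥ Iwk)) := by
  have hc : cbar A B Ist Iwk = A⁻¹ *ᵥ vSt A B Ist Iwk := by
    rw [← mulVec_cbar hA Ist Iwk, Matrix.mulVec_mulVec, Matrix.nonsing_inv_mul _ hA, Matrix.one_mulVec]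
  rw [Kblock_eq_strong_add_schur hAs hA, mulVec_cbar hA, hc,
    dotProduct_comm (A⁻¹ *ᵥ vSt A B Ist Iwk) (vSt A B Ist Iwk)]

/-- **Lemma 5.1 (2), the pairing** (l.1498–1499): `c · v = c̄ · vˢᵗ + cʷᵏ · (vʷᵏ − BᵀA⁻¹vˢᵗ)` (`A` symmetric).
[cite: KaloshinZhang2018, Lemma 5.1 (2) l.1470–1479, proof l.1496–1499] -/
theorem lemma51_pairing (hAs : A.IsSymm) (cst vst : Fin m → ℝ) (cwk vwk : Fin w → ℝ) :
    cst ⬝ᵥ vst + cwk ⬝ᵥ vwk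
      = cbar A B cst cwk ⬝ᵥ vst + cwk ⬝ᵥ (vwk - Bᵀ *ᵥ (A⁻¹ *ᵥ vst)) := by
  have h : cwk ⬝ᵥ (Bᵀ *ᵥ (A⁻¹ *ᵥ vst)) = (A⁻¹ *ᵥ (B *ᵥ cwk)) ⬝ᵥ vst := by
    rw [Matrix.dotProduct_mulVec cwk Bᵀ, Matrix.vecMul_transpose, dotProduct_mulVec_symm hAs.inv,
      dotProduct_comm]
  rw [cbar, add_dotProduct, dotProduct_sub, h]
  ring

/-- **Lemma 5.1 (2), completing the square** (l.1499–1501): for symmetric invertible `S` (`= C̃`),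
`½ w·S⁻¹w − cʷᵏ·w = ½ (w − S cʷᵏ)·S⁻¹(w − S cʷᵏ) − ½ cʷᵏ·S cʷᵏ` — with the MINUS sign of eq. (Lsc-split).
[cite: KaloshinZhang2018, Lemma 5.1 (2) eq. (Lsc-split) l.1476–1479, proof l.1499–1501] -/
theorem lemma51_square {S : Matrix (Fin w) (Fin w) ℝ} (hS : S.IsSymm)
    (hSu : IsUnit S.det) (cwk wv : Fin w → ℝ) :
    (1 / 2) * (wv ⬝ᵥ (S⁻¹ *ᵥ wv)) - cwk ⬝ᵥ wv
      = (1 / 2) * ((wv - S *ᵥ cwk) ⬝ᵥ (S⁻¹ *ᵥ (wv - S *ᵥ cwk))) - (1 / 2) * (cwk ⬝ᵥ (S *ᵥ cwk)) := by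
  have h1 : (S *ᵥ cwk) ⬝ᵥ (S⁻¹ *ᵥ wv) = cwk ⬝ᵥ wv := by
    rw [← Matrix.vecMul_transpose S cwk, hS.eq, ← Matrix.dotProduct_mulVec, Matrix.mulVec_mulVec,
      Matrix.mul_nonsing_inv _ hSu, Matrix.one_mulVec]
  have h2 : wv ⬝ᵥ (S⁻¹ *ᵥ (S *ᵥ cwk)) = cwk ⬝ᵥ wv := by
    rw [Matrix.mulVec_mulVec, Matrix.nonsing_inv_mul _ hSu, Matrix.one_mulVec, dotProduct_comm]
  have h3 : (S *ᵥ cwk) ⬝ᵥ (S⁻¹ *ᵥ (S *ᵥ cwk)) = cwk ⬝ᵥ (S *ᵥ cwk) := by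
    rw [Matrix.mulVec_mulVec, Matrix.nonsing_inv_mul _ hSu, Matrix.one_mulVec, dotProduct_comm]
  rw [Matrix.mulVec_sub, sub_dotProduct, dotProduct_sub, dotProduct_sub, h1, h2, h3]
  ring

/-- `C̃` is symmetric when `A` and `C` are (l.746 "symmetric"). [cite: KaloshinZhang2018, §2.3 l.746] -/
theorem schurC_transpose (hAs : A.IsSymm) (hCs : C.IsSymm) :
    (schurC A B C)ᵀ = schurC A B C := by
  rw [schurC, Matrix.transpose_sub, Matrix.transpose_mul, Matrix.transpose_mul, Matrix.transpose_transpose,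
    Matrix.transpose_nonsing_inv, hAs.eq, hCs.eq, Matrix.mul_assoc]

/-- **`C̃` is positive definite if `∂²K` is** (l.2321–2323: "C̃ is positive definite if S is"; l.746
"invertible"): evaluate the block form at `(cˢᵗ, cʷᵏ) = (−A⁻¹Bcʷᵏ, cʷᵏ)`, where `c̄ = 0`.
[cite: KaloshinZhang2018, §2.3 l.746, App. l.2319–2323] -/
theorem schurC_posDef (hAs : A.IsSymm) (hCs : C.IsSymm) (hA : IsUnit A.det)
    (hpos : ∀ (cst : Fin m → ℝ) (cwk : Fin w → ℝ), cwk ≠ 0 → 0 < Kblock A B C cst cwk) :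
    (schurC A B C).PosDef := by
  refine Matrix.PosDef.of_dotProduct_mulVec_pos ?_ fun x hx => ?_
  · show (schurC A B C)ᴴ = schurC A B C
    rw [Matrix.conjTranspose_eq_transpose_of_trivial, schurC_transpose hAs hCs]
  · have hc : cbar A B (-(A⁻¹ *ᵥ (B *ᵥ x))) x = 0 := by
      simp [cbar]
    have h := hpos (-(A⁻¹ *ᵥ (B *ᵥ x))) x hx
    rw [Kblock_eq_strong_add_schur hAs hA, hc, zero_dotProduct, mul_zero, zero_add] at h
    simp only [star_trivial]
    linarith

end BlockForm

/-- **The slow system's `K` in block form**: for an adapted basis `[𝓑ˢᵗ, 𝓑ʷᵏ]` and symmetric `Q₀`,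
`K(Iˢᵗ, Iʷᵏ) = ½ Iˢᵗ·A Iˢᵗ + Iˢᵗ·B Iʷᵏ + ½ Iʷᵏ·C Iʷᵏ` with `A = ∂²Kˢᵗ`, `B`, `C` of eq. (ABC) — so every
`BlockForm` identity above is an identity of the slow system.
[cite: KaloshinZhang2018, §2.3 eq. (block-ABC)–(ABC) l.699–712] -/
theorem kinetic_append_eq_Kblock {m w : ℕ} {Q₀ : Matrix (Fin n) (Fin n) ℝ} (hQ : Q₀.IsSymm)
    (𝓑st : Fin m → IntVec n) (𝓑wk : Fin w → IntVec n) (Ist : Fin m → ℝ) (Iwk : Fin w → ℝ) :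
    kinetic Q₀ (Fin.append 𝓑st 𝓑wk) (Fin.append Ist Iwk)
      = BlockForm.Kblock (hessK Q₀ 𝓑st) (blockB Q₀ 𝓑st 𝓑wk) (hessK Q₀ 𝓑wk) Ist Iwk := by
  have h2 : Iwk ⬝ᵥ ((blockB Q₀ 𝓑st 𝓑wk)ᵀ *ᵥ Ist) = Ist ⬝ᵥ (blockB Q₀ 𝓑st 𝓑wk *ᵥ Iwk) := by
    rw [Matrix.mulVec_transpose, Matrix.dotProduct_mulVec Ist, dotProduct_comm]
  unfold kinetic BlockForm.Kblock
  rw [append_dotProduct, hessK_append_mulVec_strong, hessK_append_mulVec_weak hQ, dotProduct_add,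
    dotProduct_add, h2]
  ring

/-- Hence, at a resonance with dominant structure, `C̃` of the slow system is positive definite as soon as
`Q₀ = ∂²ₚₚH₀(p₀)` is (symmetric) positive definite and `[𝓑ˢᵗ, 𝓑ʷᵏ]` is `ℤ`-independent in a resonance lattice.
[cite: KaloshinZhang2018, §2.3 l.746, App. l.2319–2323] -/
theorem schurC_posDef_of_mem (Λ : ResonanceLattice n) {m w : ℕ} {Q₀ : Matrix (Fin n) (Fin n) ℝ}
    (hQ : Q₀.PosDef) (hQs : Q₀.IsSymm) {𝓑st : Fin m → IntVec n} {𝓑wk : Fin w → IntVec n}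
    (hmem : ∀ i, Fin.append 𝓑st 𝓑wk i ∈ Λ.carrier) (hli : LinearIndependent ℤ (Fin.append 𝓑st 𝓑wk)) :
    (BlockForm.schurC (hessK Q₀ 𝓑st) (blockB Q₀ 𝓑st 𝓑wk) (hessK Q₀ 𝓑wk)).PosDef := by
  classical
  have hsymm : ∀ {d : ℕ} (𝓑 : Fin d → IntVec n), (hessK Q₀ 𝓑).IsSymm := by
    intro d 𝓑
    refine Matrix.IsSymm.ext fun i j => ?_
    rw [hessK_apply, hessK_apply, BlockForm.dotProduct_mulVec_symm hQs]
  have hwhole : (hessK Q₀ (Fin.append 𝓑st 𝓑wk)).PosDef := Λ.hessK_posDef_of_mem hQ hmem hli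
  -- the strong block is positive definite (restrict to `(Iˢᵗ, 0)`), hence invertible
  have hst : (hessK Q₀ 𝓑st).PosDef := by
    have hmem' : ∀ i, 𝓑st i ∈ Λ.carrier := fun i => by simpa using hmem (Fin.castAdd w i)
    have hli' : LinearIndependent ℤ 𝓑st := by
      have := hli.comp (Fin.castAdd w) (Fin.castAdd_injective _ _)
      convert this using 1
      funext i; simp
    exact Λ.hessK_posDef_of_mem hQ hmem' hli'
  have hA : IsUnit (hessK Q₀ 𝓑st).det := (Matrix.isUnit_iff_isUnit_det _).mp hst.isUnit
  refine BlockForm.schurC_posDef (hsymm 𝓑st) (hsymm 𝓑wk) hA fun cst cwk hcwk => ?_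
  rw [← kinetic_append_eq_Kblock hQs]
  have hne : Fin.append cst cwk ≠ 0 := by
    intro h
    apply hcwk
    funext j
    have := congrFun h (Fin.natAdd m j)
    simpa using this
  have := hwhole.dotProduct_mulVec_pos hne
  simp only [star_trivial] at this
  unfold kinetic
  linarith

/-! ### The vector fields (Xs), (Xˢᵗ_L) and the rescaling `Φ_Σ` -/

/-- A point (or tangent vector) of the universal cover `ℝᵐ × ℝᵐ × ℝʷ × ℝʷ` in the half-Lagrangian coordinates
`(φˢᵗ, vˢᵗ, φʷᵏ, Iʷᵏ)` (eq. (half-lag), l.734–738). [cite: KaloshinZhang2018, §2.3 eq. (half-lag) l.734–738] -/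
structure HalfLag (m w : ℕ) where
  /-- strong angles `φˢᵗ ∈ ℝᵐ` -/
  φst : Fin m → ℝ
  /-- strong velocities `vˢᵗ` -/
  vst : Fin m → ℝ
  /-- weak angles `φʷᵏ ∈ ℝʷ` -/
  φwk : Fin w → ℝ
  /-- weak ACTIONS `Iʷᵏ` -/
  Iwk : Fin w → ℝ

/-- The data of the vector fields: the blocks `A`, `B`, `C̃` and the gradients of the potentials
`Uˢᵗ(φˢᵗ)` and `Uʷᵏ(φˢᵗ, φʷᵏ)` (`U = Uˢᵗ + Uʷᵏ`, l.718). [cite: KaloshinZhang2018, §2.3 l.700–751] -/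
structure FieldData (m w : ℕ) where
  /-- `A = ∂²_{IˢᵗIˢᵗ}K` -/
  A : Matrix (Fin m) (Fin m) ℝ
  /-- `B = ∂²_{IˢᵗIʷᵏ}K` -/
  B : Matrix (Fin m) (Fin w) ℝ
  /-- `C̃ = C − BᵀA⁻¹B` -/
  Ct : Matrix (Fin w) (Fin w) ℝ
  /-- `∂_{φˢᵗ} Uˢᵗ (φˢᵗ)` -/
  gradUst : (Fin m → ℝ) → (Fin m → ℝ)
  /-- `∂_{φˢᵗ} Uʷᵏ (φˢᵗ, φʷᵏ)` -/
  gradStUwk : (Fin m → ℝ) → (Fin w → ℝ) → (Fin m → ℝ)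
  /-- `∂_{φʷᵏ} Uʷᵏ (φˢᵗ, φʷᵏ)` -/
  gradWkUwk : (Fin m → ℝ) → (Fin w → ℝ) → (Fin w → ℝ)

namespace FieldData

variable {m w : ℕ} (𝔇 : FieldData m w)

/-- **(Xs)**, the slow system in half-Lagrangian coordinates (l.747–752): `φ̇ˢᵗ = vˢᵗ`,
`v̇ˢᵗ = A ∂_{φˢᵗ}U + B ∂_{φʷᵏ}U`, `φ̇ʷᵏ = BᵀA⁻¹vˢᵗ + C̃ Iʷᵏ`, `İʷᵏ = ∂_{φʷᵏ}U`, with `U = Uˢᵗ + Uʷᵏ` — typed with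
the sign of `vWk_eq_halfLagrangian` in the `φ̇ʷᵏ` equation (the text prints `− C̃ Iʷᵏ`, see there).
[cite: KaloshinZhang2018, §2.3 eq. (Xs) l.747–753] -/
def Xs (z : HalfLag m w) : HalfLag m w where
  φst := z.vst
  vst := 𝔇.A *ᵥ (𝔇.gradUst z.φst + 𝔇.gradStUwk z.φst z.φwk) + 𝔇.B *ᵥ 𝔇.gradWkUwk z.φst z.φwk
  φwk := 𝔇.Bᵀ *ᵥ (𝔇.A⁻¹ *ᵥ z.vst) + 𝔇.Ct *ᵥ z.Iwk
  Iwk := 𝔇.gradWkUwk z.φst z.φwk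

/-- **(Xˢᵗ_L)**, the trivial lift of the strong Lagrangian vector field (Xst) `φ̇ˢᵗ = vˢᵗ, v̇ˢᵗ = A ∂_{φˢᵗ}Uˢᵗ`
(l.727–729) to the cover: `φ̇ʷᵏ = 0`, `İʷᵏ = 0` (l.756–770; eq. (XstL) prints `A∂_{φˢᵗ}U` where (Xst) and the
commented source l.759 have `Uˢᵗ`). [cite: KaloshinZhang2018, §2.3 eq. (Xst) l.727–729, eq. (XstL) l.756–770] -/
def XstL (z : HalfLag m w) : HalfLag m w where
  φst := z.vst
  vst := 𝔇.A *ᵥ 𝔇.gradUst z.φst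
  φwk := 0
  Iwk := 0

/-- The strong projection of `Xˢ − Xˢᵗ_L` is `(0, A ∂_{φˢᵗ}Uʷᵏ + B ∂_{φʷᵏ}Uʷᵏ)` (l.730–731: "we only need to show
‖B ∂_{φʷᵏ}U‖ → 0" — the term `A ∂_{φˢᵗ}Uʷᵏ`, equally small with `‖Uʷᵏ‖_{C²}`, is elided there).
[cite: KaloshinZhang2018, §2.3 l.730–731] -/
theorem strongProjection_sub (z : HalfLag m w) :
    (𝔇.Xs z).φst - (𝔇.XstL z).φst = 0 ∧
      (𝔇.Xs z).vst - (𝔇.XstL z).vst = 𝔇.A *ᵥ 𝔇.gradStUwk z.φst z.φwk + 𝔇.B *ᵥ 𝔇.gradWkUwk z.φst z.φwk := by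
  refine ⟨sub_self _, ?_⟩
  simp only [Xs, XstL, Matrix.mulVec_add]
  abel

end FieldData

namespace HalfLag

variable {m w : ℕ}

/-- **`Φ_Σ`** (eq. (rescale), l.772–774): `(φˢᵗ, vˢᵗ, φʷᵏ, Iʷᵏ) ↦ (φˢᵗ, vˢᵗ, Σ⁻¹φʷᵏ, Σ Iʷᵏ)`,
`Σ = diag{σ₁, ⋯, σ_w}`. [cite: KaloshinZhang2018, §2.3 eq. (rescale) l.771–774] -/
def rescale (σ : Fin w → ℝ) (z : HalfLag m w) : HalfLag m w where
  φst := z.φst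
  vst := z.vst
  φwk := fun j => (σ j)⁻¹ * z.φwk j
  Iwk := fun j => σ j * z.Iwk j

/-- `Φ_Σ⁻¹`. [cite: KaloshinZhang2018, §2.3 eq. (rescale) l.771–774] -/
def invRescale (σ : Fin w → ℝ) (z : HalfLag m w) : HalfLag m w where
  φst := z.φst
  vst := z.vst
  φwk := fun j => σ j * z.φwk j
  Iwk := fun j => (σ j)⁻¹ * z.Iwk j

/-- `Φ_Σ⁻¹ ∘ Φ_Σ = id` for `σ_j ≠ 0`. [folklore] -/
theorem invRescale_rescale {σ : Fin w → ℝ} (hσ : ∀ j, σ j ≠ 0) (z : HalfLag m w) :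
    invRescale σ (rescale σ z) = z := by
  cases z
  simp only [invRescale, rescale, HalfLag.mk.injEq, true_and]
  constructor <;> funext j <;> field_simp [hσ j]

/-- **The rescaled vector field** (eq. (rescaling), l.776–781, second form): `X̃(φˢᵗ, vˢᵗ, φʷᵏ, Iʷᵏ) =
Φ_Σ⁻¹ X(φˢᵗ, vˢᵗ, Σ⁻¹φʷᵏ, Σ Iʷᵏ)` (the linear map `Φ_Σ⁻¹` applied to the vector `X(Φ_Σ z)`; the first form
printed on l.777, `Φ_Σ⁻¹ X ∘ Φ_Σ⁻¹`, differs from the second by `Σ ↔ Σ⁻¹`; we type the explicit second form).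
[cite: KaloshinZhang2018, §2.3 eq. (rescaling) l.776–781] -/
def rescaledField (σ : Fin w → ℝ) (X : HalfLag m w → HalfLag m w) (z : HalfLag m w) : HalfLag m w :=
  invRescale σ (X (rescale σ z))

/-- **"`Xˢᵗ_L` is unchanged under the rescaling"** (l.782). [cite: KaloshinZhang2018, §2.3 l.782] -/
theorem rescaledField_XstL (σ : Fin w → ℝ) (𝔇 : FieldData m w) :
    rescaledField σ 𝔇.XstL = 𝔇.XstL := by
  funext z
  simp only [rescaledField, invRescale, rescale, FieldData.XstL, Pi.zero_apply, mul_zero]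
  rfl

end HalfLag

/-! ### The abstract space `Ω^{m,d}_{κ,q}(𝓑ˢᵗ)` of dominant Hamiltonians and the shape of Theorem 2.1 -/

/-- A point of `Ω^{m,d}(𝓑ˢᵗ) = (ℤⁿ⁺¹)ᵈ × ℝⁿ × C²(𝕋ᵐ) × C²(𝕋ᵐ⁺¹) × ⋯ × C²(𝕋ᵈ)` with `𝓑ˢᵗ` fixed (l.636–655),
recorded schematically: the weak vectors `𝓑ʷᵏ`, the point `p₀`, and — of the potentials `Uˢᵗ`,
`𝓤ʷᵏ = {U₁ʷᵏ, ⋯, U_wʷᵏ}` (`Uⱼʷᵏ` a function of `φ₁, ⋯, φ_{j+m}`) — only the table of `C²` norms `‖Uⱼʷᵏ‖_{C²}`,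
which is all the membership conditions of `Ω_{κ,q}` speak about. [cite: KaloshinZhang2018, §2.2 l.636–663] -/
structure OmegaPoint (n m w : ℕ) where
  /-- `𝓑ʷᵏ = [k₁ʷᵏ, ⋯, k_wʷᵏ]` -/
  𝓑wk : Fin w → IntVec n
  /-- `p₀ ∈ ℝⁿ` -/
  p₀ : Fin n → ℝ
  /-- `‖Uⱼʷᵏ‖_{C²}`, `j = 1, ⋯, w` -/
  normUwk : Fin w → ℝ
  /-- norms are non-negative -/
  normUwk_nonneg : ∀ j, 0 ≤ normUwk j

namespace OmegaPoint

variable {m w : ℕ}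

/-- **`Ω^{m,d}_{κ,q}(𝓑ˢᵗ)`** (l.657–663, verbatim): "(1) For any 1 ≤ i < j ≤ d−m, |kᵢʷᵏ| ≤ κ(1 + |kⱼʷᵏ|). (2) For
each 1 ≤ j ≤ d−m, ‖Uⱼʷᵏ‖_{C²} ≤ κ |kⱼʷᵏ|^{−q}." (`|·|` the sup-norm; real power `rpow`).
[cite: KaloshinZhang2018, §2.2 l.657–664] -/
structure InOmega (κ q : ℝ) (ω : OmegaPoint n m w) : Prop where
  /-- (1) the weak vectors are approximately increasing -/
  ordered : ∀ i j : Fin w, i < j → (supNorm (ω.𝓑wk i) : ℝ) ≤ κ * (1 + (supNorm (ω.𝓑wk j) : ℝ))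
  /-- (2) polynomial decay of the weak potentials -/
  decay : ∀ j : Fin w, ω.normUwk j ≤ κ * (supNorm (ω.𝓑wk j) : ℝ) ^ (-q)

/-- `𝔐(𝓑ʷᵏ) = min_{1 ≤ j ≤ d−m} |kⱼʷᵏ|` (l.664–665), in `ℕ∞` (`⊤` for `w = 0`). [cite: KaloshinZhang2018, §2.2 l.664–665] -/
def minWeak (ω : OmegaPoint n m w) : ℕ∞ := ⨅ j : Fin w, (supNorm (ω.𝓑wk j) : ℕ∞)

/-- **"then in `Ω_{κ,q}(𝓑ˢᵗ)` we have `‖Uⱼʷᵏ‖ ≤ κ 𝔐(𝓑ʷᵏ)^{−q}`"** (l.666–667): for `q ≥ 0` and any positive lower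
bound `M ≤ |kⱼʷᵏ|` of the weak vectors (in particular `M = 𝔐(𝓑ʷᵏ)` when the weak vectors are non-zero).
[cite: KaloshinZhang2018, §2.2 l.664–668] -/
theorem InOmega.norm_le_of_minWeak {κ q : ℝ} {ω : OmegaPoint n m w} (h : InOmega κ q ω) (hκ : 0 ≤ κ)
    (hq : 0 ≤ q) {M : ℝ} (hM : 0 < M) (hMle : ∀ j, M ≤ (supNorm (ω.𝓑wk j) : ℝ)) (j : Fin w) :
    ω.normUwk j ≤ κ * M ^ (-q) := by
  refine (h.decay j).trans ?_
  refine mul_le_mul_of_nonneg_left ?_ hκ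
  exact Real.rpow_le_rpow_of_nonpos hM (hMle j) (neg_nonpos.mpr hq)

end OmegaPoint

/-- **The quantifier SHAPE of Theorem 2.1** (thm:basis-norm, l.600–613; restated l.670–674), for fixed data:
irreducible resonance lattices `Λˢᵗ ⊂ Λ` of ranks `m < d = m + w`, an ordered basis `𝓑ˢᵗ` of `Λˢᵗ`, the sup-norms,
and an abstract assignment `normUwk 𝓑ʷᵏ j = ‖Z_{𝓑_{j+m}} − Z_{𝓑_{j+m−1}}‖_{C²}` (depending on `H₁`, `p₀`): "there
exists κ = κ(H₀, 𝓑ˢᵗ, n) > 1, integer vectors 𝓑ʷᵏ = [k₁ʷᵏ, ⋯, k_{d−m}ʷᵏ] with [𝓑ˢᵗ, 𝓑ʷᵏ] forming an adapted basis,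
such that (1) for any 1 ≤ i < j ≤ d − m, |kᵢʷᵏ| < κ(1 + |kⱼʷᵏ|); (2) for 1 ≤ j ≤ d − m,
‖Uʷᵏ_{p₀,𝓑_{j+m−1},𝓑_{j+m}}‖_{C²} ≤ κ |kⱼʷᵏ|^{−r+n+2(d−m)+4}" (`H₁ ∈ Cʳ`, `r > n + 2(d−m) + 4`, `‖H₁‖_{Cʳ} = 1`).
This is a PREDICATE on the data (the theorem asserts it for the norms coming from `H₁`); it is not assumed
anywhere in this file. [cite: KaloshinZhang2018, Theorem 2.1 l.600–613, l.670–674] -/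
def Theorem21Shape {m w : ℕ} (r : ℕ) (Λst Λ : ResonanceLattice n) (𝓑st : Fin m → IntVec n)
    (normUwk : (Fin w → IntVec n) → Fin w → ℝ) : Prop :=
  ∃ κ : ℝ, 1 < κ ∧ ∃ 𝓑wk : Fin w → IntVec n,
    ResonanceLattice.IsAdaptedBasis Λst Λ 𝓑st 𝓑wk ∧
    (∀ i j : Fin w, i < j → (supNorm (𝓑wk i) : ℝ) < κ * (1 + (supNorm (𝓑wk j) : ℝ))) ∧
    (∀ j : Fin w, normUwk 𝓑wk j ≤ κ * (supNorm (𝓑wk j) : ℝ) ^ (-(r : ℝ) + n + 2 * w + 4))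

/-- Theorem 2.1's conclusion places the slow system in `Ω^{m,d}_{κ, r−n−2(d−m)−4}(𝓑ˢᵗ)` (the restatement
l.670–674): the exponent bookkeeping `−r + n + 2w + 4 = −(r − n − 2w − 4)`. [cite: KaloshinZhang2018, §2.2 l.670–674] -/
theorem Theorem21Shape.inOmega {m w : ℕ} {r : ℕ} {Λst Λ : ResonanceLattice n} {𝓑st : Fin m → IntVec n}
    {normUwk : (Fin w → IntVec n) → Fin w → ℝ} (hnn : ∀ 𝓑wk j, 0 ≤ normUwk 𝓑wk j)
    (h : Theorem21Shape r Λst Λ 𝓑st normUwk) (p₀ : Fin n → ℝ) :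
    ∃ κ : ℝ, 1 < κ ∧ ∃ 𝓑wk : Fin w → IntVec n, ResonanceLattice.IsAdaptedBasis Λst Λ 𝓑st 𝓑wk ∧
      OmegaPoint.InOmega (m := m) κ ((r : ℝ) - n - 2 * w - 4)
        ⟨𝓑wk, p₀, normUwk 𝓑wk, hnn 𝓑wk⟩ := by
  obtain ⟨κ, hκ, 𝓑wk, had, h1, h2⟩ := h
  refine ⟨κ, hκ, 𝓑wk, had, ⟨fun i j hij => (h1 i j hij).le, fun j => ?_⟩⟩
  have : -((r : ℝ) - n - 2 * w - 4) = -(r : ℝ) + n + 2 * w + 4 := by ring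
  rw [this]
  exact h2 j

end Literature.Dynamics.Hamiltonian.KaloshinZhang2018
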